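import Literature.AlgebraicGeometry.Resolution.ApproximationCoefficient
import Literature.AlgebraicGeometry.Resolution.OstrowskiRamification
import Literature.AlgebraicGeometry.Resolution.HenselizationHenselian
import Literature.AlgebraicGeometry.Resolution.HenselizedFunctionFieldsImmediate
import HarnessLib

/-!
# Lemmas for the pull-down of henselian rationality through tame extensions (Kuhlmann–Vlahu 2014, §14)

Topic: `Literature/AlgebraicGeometry/Resolution` (valued function fields). F.-V. Kuhlmann,
I. Vlahu, *The relative approximation degree in valued function fields*, Math. Z. 276 (2014) =
arXiv:1304.0200, §14 ("A pull down principle for henselian rationality through tame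
extensions") — the algebraic counterpart of the descent step of M. Temkin, *Inseparable local
uniformization*, J. Algebra 373 (2013), Thm. 3.2.3 (Step 1), on the way to the named fact
`Temkin2013RelativeCurveSmoothFibre`. This file PROVES two ingredients:

> **Lemma 14.3.** Assume that `ρ` is a valuation preserving automorphism of `L(x)^h` such that
> `ρ(L) = L`. Then `L(x)^h = L(ρ x)^h`.

rendered inside an ambient algebraically closed valued field `(Ω, V)`: for a henselian
`F ≤ Ω`, a finite `M ⊇ F` inside `Ω`, `σ ∈ Aut(M|F)` (valuation preserving, `F` being
henselian) mapping a set `B ⊆ M` into itself, and `x ∈ M` with `M ⊆ B(x)^h`: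
also `M ⊆ B(σ x)^h` (`coe_subset_henselization_closure_of_algEquiv`). The printed argument
("`ρ⁻¹(L(ρ x)^h)` is henselian; it is therefore equal to `L(x)^h`") is followed, with the
transport of henselianity along a valued field isomorphism made explicit
(`IsHenselianField.of_ringEquiv`);

and the computation inside the proof of **Lemma 12.3 / Lemma 14.4** that a combination
`y = ∑ kᵢ yᵢ` of elements `yᵢ` of relative approximation degree `1` at `x`, with scalars `kᵢ`
not cancelling against approximation coefficients `dᵢ`, again has relative approximation degree
`1` at `x`, here in the CONCRETE form consumed by Prop. 10.5 (`mem_henselization_of_degree_one`,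
`ApproximationDegreeOneGenerates.lean`): `g = ∑ kᵢ f^{[i]}` is a good approximant of `y`
(`|y − g(x)| < |y − b|` for all `b ∈ K`) with `|g(x) − g(c)| = |∑ kᵢ dᵢ| · |x − c|` for `c ↗ x`
(`good_approximant_sum`; from `approximationDegree_one_sum` and Lemma 8.2).

## Content (PROVED; no definitions, no named facts)

* `IsHenselianField.of_ringEquiv` — henselianity along an isomorphism of valued fields.
* `coe_subset_henselization_closure_of_algEquiv` — Lemma 14.3 [cite: KuhlmannVlahu2014, Lemma 14.3].
* `good_approximant_sum` — Lemma 12.3 in concrete degree-`1` form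
  [cite: KuhlmannVlahu2014, Lemma 12.3].

## Sources

* F.-V. Kuhlmann, I. Vlahu, Math. Z. 276 (2014) = arXiv:1304.0200, §12 (Lemma 12.3), §14
  (Lemmas 14.3, 14.4), pp. 23–26. [KuhlmannVlahu2014]
-/

noncomputable section

open Polynomial Finset IsLocalRing

namespace Literature.AlgebraicGeometry.Resolution

universe u

/-! ### Henselianity along an isomorphism of valued fields -/

section Transport

variable {K K' : Type u} [Field K] [Field K']

/-- **Henselianity is transported along an isomorphism of valued fields**: if `e : K ≃ K'`
maps the valuation ring `O` onto `O'` (`e⁻¹(O') = O`) and `(K, O)` is henselian, then so is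
`(K', O')`. [folklore] -/
theorem IsHenselianField.of_ringEquiv (e : K ≃+* K') {O : ValuationSubring K}
    {O' : ValuationSubring K'} (hO : O'.comap e.toRingHom = O) (h : IsHenselianField K O) :
    IsHenselianField K' O' := by
  intro L _ _ hL O₁ O₂ h₁ h₂
  letI algKL : Algebra K L := ((algebraMap K' L).comp e.toRingHom).toAlgebra
  have halgmap : algebraMap K L = (algebraMap K' L).comp e.toRingHom := rfl
  haveI : Algebra.IsAlgebraic K L := by
    refine ⟨fun x => ?_⟩
    have hx : IsAlgebraic K' ((RingHom.id L) x) := hL.isAlgebraic x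
    exact hx.of_ringHom_of_comp_eq e.toRingHom (RingHom.id L) e.surjective
      Function.injective_id (by rw [halgmap]; rfl)
  have hc : ∀ Oi : ValuationSubring L, Oi.comap (algebraMap K' L) = O' →
      Oi.comap (algebraMap K L) = O := fun Oi hOi => by
    rw [halgmap, ← ValuationSubring.comap_comap, hOi, hO]
  exact h L inferInstance O₁ O₂ (hc O₁ h₁) (hc O₂ h₂)

end Transport

/-! ### Kuhlmann–Vlahu 2014, Lemma 14.3 -/

section Lemma143

variable {Ω : Type u} [Field Ω] [IsAlgClosed Ω] (V : ValuationSubring Ω) {F : Subfield Ω}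
  (M : IntermediateField F Ω)

/-- **Kuhlmann–Vlahu 2014, Lemma 14.3** ("Assume that `ρ` is a valuation preserving
automorphism of `L(x)^h` such that `ρ(L) = L`. Then `L(x)^h = L(ρ x)^h`"), ambient form. Let
`F ≤ Ω` be henselian, `M ⊇ F` finite inside `Ω`, `σ ∈ Aut(M|F)`, `B ⊆ M` a subset mapped
into itself by `σ`, and `x ∈ M` with `M ⊆ B(x)^h`. Then `M ⊆ B(σ x)^h`. PROVED as printed:
`H' = B(σ x)^h ≤ M` (`M` is henselian); the image `σ⁻¹(H')` is a henselian subfield of `Ω`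
(`σ` preserves the valuation over the henselian `F`; `IsHenselianField.of_ringEquiv`) containing
`B` and `x`, hence `B(x)^h`, hence `M`; so `H' ⊇ σ(M) = M`. [cite: KuhlmannVlahu2014, Lemma 14.3] -/
theorem coe_subset_henselization_closure_of_algEquiv
    (hF : IsHenselianField F (V.comap (algebraMap F Ω))) [FiniteDimensional F M]
    (σ : M ≃ₐ[F] M) {B : Set Ω} (hBM : B ⊆ M)
    (hσB : ∀ z : M, (z : Ω) ∈ B → ((σ z : M) : Ω) ∈ B) (x : M)
    (hM : (M : Set Ω) ⊆ henselization V (Subfield.closure (B ∪ {(x : Ω)}))) :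
    (M : Set Ω) ⊆ henselization V (Subfield.closure (B ∪ {((σ x : M) : Ω)})) := by
  classical
  set Mf : Subfield Ω := M.toSubfield with hMfdef
  have hMf : ∀ w : Ω, w ∈ Mf ↔ w ∈ M := fun w => Iff.rfl
  set S' : Subfield Ω := Subfield.closure (B ∪ {((σ x : M) : Ω)}) with hS'def
  set H' : Subfield Ω := henselization V S' with hH'def
  -- `M` is henselian, so `H' ≤ M`
  have hFM : F ≤ Mf := fun c hc => M.algebraMap_mem ⟨c, hc⟩
  haveI : Algebra.IsAlgebraic F M := Algebra.IsAlgebraic.of_finite F M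
  have hMalg : ∀ a ∈ Mf, IsAlgebraic F a := fun a ha =>
    IntermediateField.isAlgebraic_iff.mp (Algebra.IsAlgebraic.isAlgebraic (⟨a, ha⟩ : M))
  have hMhens : IsHenselianField Mf (V.comap (algebraMap Mf Ω)) :=
    IsHenselianField.of_subfield_algebraic V hFM hMalg hF
  have hS'M : S' ≤ Mf :=
    Subfield.closure_le.mpr (Set.union_subset hBM (Set.singleton_subset_iff.mpr (σ x).2))
  have hH'M : H' ≤ Mf := henselization_le_of_isHenselianField V S' hS'M hMhens
  have hH' : IsHenselianField H' (V.comap (algebraMap H' Ω)) :=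
    Kuhlmann2010HenselizationIsHenselian_holds Ω V S'
  -- `τ = σ⁻¹` preserves the valuation
  set τ : M ≃ₐ[F] M := σ.symm with hτdef
  have hval : ∀ (ρ : M ≃ₐ[F] M) (z : M), V.valuation ((ρ z : M) : Ω) = V.valuation (z : Ω) :=
    fun ρ z => hF.valuation_algHom_apply V ((IsScalarTower.toAlgHom F M Ω).comp ρ.toAlgHom) z
  -- the image `Hτ = τ(H')` as a subfield of `Ω`
  set φ : M →+* Ω := (algebraMap M Ω).comp τ.toAlgHom.toRingHom with hφdef
  have hφ : ∀ z : M, φ z = ((τ z : M) : Ω) := fun z => rfl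
  set Hτ : Subfield Ω := (H'.comap (algebraMap M Ω)).map φ with hHτdef
  have hmemHτ : ∀ w : Ω, w ∈ Hτ ↔ ∃ z : M, (z : Ω) ∈ H' ∧ ((τ z : M) : Ω) = w := by
    intro w
    rw [hHτdef, Subfield.mem_map]
    constructor
    · rintro ⟨z, hz, rfl⟩
      exact ⟨z, hz, rfl⟩
    · rintro ⟨z, hz, rfl⟩
      exact ⟨z, hz, rfl⟩
  have hHτM : Hτ ≤ Mf := by
    intro w hw
    obtain ⟨z, -, rfl⟩ := (hmemHτ w).mp hw
    exact (τ z).2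
  -- the isomorphism `H' ≃ Hτ`
  have hH'mem : ∀ z : H', ((z : Ω)) ∈ M := fun z => hH'M z.2
  let ψ : H' →+* Hτ :=
    { toFun := fun z => ⟨((τ ⟨z, hH'mem z⟩ : M) : Ω), (hmemHτ _).mpr ⟨⟨z, hH'mem z⟩, z.2, rfl⟩⟩
      map_one' := by
        apply Subtype.ext
        change ((τ ⟨((1 : H') : Ω), hH'mem 1⟩ : M) : Ω) = 1
        rw [show (⟨((1 : H') : Ω), hH'mem 1⟩ : M) = 1 from rfl, map_one]
        rfl
      map_mul' := fun a b => by
        apply Subtype.ext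
        change ((τ ⟨((a * b : H') : Ω), hH'mem (a * b)⟩ : M) : Ω) =
          ((τ ⟨(a : Ω), hH'mem a⟩ : M) : Ω) * ((τ ⟨(b : Ω), hH'mem b⟩ : M) : Ω)
        rw [show (⟨((a * b : H') : Ω), hH'mem (a * b)⟩ : M) = ⟨(a : Ω), hH'mem a⟩ * ⟨(b : Ω), hH'mem b⟩
          from rfl, map_mul]
        rfl
      map_zero' := by
        apply Subtype.ext
        change ((τ ⟨((0 : H') : Ω), hH'mem 0⟩ : M) : Ω) = 0
        rw [show (⟨((0 : H') : Ω), hH'mem 0⟩ : M) = 0 from rfl, map_zero]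
        rfl
      map_add' := fun a b => by
        apply Subtype.ext
        change ((τ ⟨((a + b : H') : Ω), hH'mem (a + b)⟩ : M) : Ω) =
          ((τ ⟨(a : Ω), hH'mem a⟩ : M) : Ω) + ((τ ⟨(b : Ω), hH'mem b⟩ : M) : Ω)
        rw [show (⟨((a + b : H') : Ω), hH'mem (a + b)⟩ : M) = ⟨(a : Ω), hH'mem a⟩ + ⟨(b : Ω), hH'mem b⟩
          from rfl, map_add]
        rfl }
  have hψ : ∀ z : H', ((ψ z : Hτ) : Ω) = ((τ ⟨z, hH'mem z⟩ : M) : Ω) := fun z => rfl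
  have hψbij : Function.Bijective ψ := by
    refine ⟨ψ.injective, fun w => ?_⟩
    obtain ⟨z, hz, hzw⟩ := (hmemHτ w).mp w.2
    refine ⟨⟨z, hz⟩, Subtype.ext ?_⟩
    rw [hψ]
    exact hzw
  set e : H' ≃+* Hτ := RingEquiv.ofBijective ψ hψbij with hedef
  have he : ∀ z : H', ((e z : Hτ) : Ω) = ((τ ⟨z, hH'mem z⟩ : M) : Ω) := fun z => rfl
  -- `e` respects the valuation rings
  have hecomap : (V.comap (algebraMap Hτ Ω)).comap e.toRingHom = V.comap (algebraMap H' Ω) := by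
    ext z
    simp only [ValuationSubring.mem_comap]
    change ((e z : Hτ) : Ω) ∈ V ↔ (z : Ω) ∈ V
    rw [he, ← V.valuation_le_one_iff, ← V.valuation_le_one_iff, hval τ]
  have hHτ : IsHenselianField Hτ (V.comap (algebraMap Hτ Ω)) :=
    IsHenselianField.of_ringEquiv e hecomap hH'
  -- `B ⊆ Hτ` and `x ∈ Hτ`
  have hS'H' : S' ≤ H' := le_henselization V S'
  have hBHτ : B ⊆ Hτ := by
    intro b hb
    refine (hmemHτ b).mpr ⟨σ ⟨b, hBM hb⟩, hS'H' (Subfield.subset_closure (Or.inl (hσB _ hb))), ?_⟩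
    rw [hτdef, AlgEquiv.symm_apply_apply]
  have hxHτ : (x : Ω) ∈ Hτ := by
    refine (hmemHτ x).mpr ⟨σ x, hS'H' (Subfield.subset_closure (Or.inr rfl)), ?_⟩
    rw [hτdef, AlgEquiv.symm_apply_apply]
  have hSHτ : Subfield.closure (B ∪ {(x : Ω)}) ≤ Hτ :=
    Subfield.closure_le.mpr (Set.union_subset hBHτ (Set.singleton_subset_iff.mpr hxHτ))
  have hMHτ : (M : Set Ω) ⊆ Hτ := fun w hw =>
    henselization_le_of_isHenselianField V _ hSHτ hHτ (hM hw)
  -- hence `M = τ(M) ⊆ τ⁻¹(H')`-wise: for `w ∈ M`, `τ w ∈ Hτ = τ(H')` gives `w ∈ H'`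
  intro w hw
  obtain ⟨z', hz'H', hz'w⟩ := (hmemHτ ((τ ⟨w, hw⟩ : M) : Ω)).mp (hMHτ (τ ⟨w, hw⟩).2)
  have hz' : z' = ⟨w, hw⟩ := τ.injective (Subtype.ext hz'w)
  rw [hz'] at hz'H'
  exact hz'H'

end Lemma143

/-! ### Kuhlmann–Vlahu 2014, Lemma 12.3 in concrete degree-one form -/

section Sum

variable {Ω : Type u} [Field Ω] (V : ValuationSubring Ω) (K : Subfield Ω)

/-- **Kuhlmann–Vlahu 2014, Lemma 12.3 / proof of Lemma 14.4, concrete form in relative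
approximation degree `1`.** Let `x ∉ K` with `(K(x)|K, V)` immediate (`hval`, `hres`), of
transcendental approximation type (`h3`, `htrans`). For `i ∈ s` let `yᵢ ∈ Ω` have the GOOD
approximant `fᵢ(x)`, `fᵢ` over `K` (`|yᵢ − fᵢ(x)| < |yᵢ − b|` for all `b ∈ K`), of relative
approximation degree `1` with constant `βᵢ` and approximation coefficient `dᵢ ∈ K` (`|dᵢ| = βᵢ`,
`|(fᵢ)₁(c) − dᵢ| < βᵢ` and the higher Taylor terms dominated, for `c ∈ K` close to `x`), and let
`kᵢ ∈ K` be scalars with `|kᵢ dᵢ| ≤ |∑ kᵢ dᵢ| ≠ 0`. Then `g = ∑ kᵢ fᵢ` is a polynomial over `K`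
which is a GOOD approximant of `y = ∑ kᵢ yᵢ` — `|y − g(x)| < |y − b|` for all `b ∈ K` — and
`|g(x) − g(c)| = |∑ kᵢ dᵢ| · |x − c|` for `c ∈ K` close to `x`: `𝐡_K(x:y) = 1` in the concrete
sense of `mem_henselization_of_degree_one`. [cite: KuhlmannVlahu2014, Lemma 12.3] -/
theorem good_approximant_sum {ι : Type*} (s : Finset ι) {x : Ω}
    (htrans : ∀ P : Polynomial Ω, (∀ k, P.coeff k ∈ K) → P.eval x = 0 → P = 0)
    (hval : ∀ w ∈ Subfield.closure ((K : Set Ω) ∪ {x}), w ≠ 0 → ∃ b ∈ K,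
      V.valuation w = V.valuation b)
    (hres : ∀ w ∈ Subfield.closure ((K : Set Ω) ∪ {x}), w ∈ V → ∃ c ∈ K,
      V.valuation (w - c) < 1)
    (h3 : ∀ g : Polynomial Ω, (∀ k, g.coeff k ∈ K) → ∃ a₀ ∈ K, ∃ α : V.ValueGroup,
      ∀ a ∈ K, V.valuation (x - a) ≤ V.valuation (x - a₀) → V.valuation (g.eval a) = α)
    (f : ι → Polynomial Ω) (hf : ∀ i ∈ s, ∀ k, (f i).coeff k ∈ K)
    (y : ι → Ω) (β : ι → V.ValueGroup) (d kk : ι → Ω) (hkk : ∀ i ∈ s, kk i ∈ K)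
    (hd : ∀ i ∈ s, d i ∈ K ∧ V.valuation (d i) = β i)
    (hgood : ∀ i ∈ s, ∀ b ∈ K, V.valuation (y i - (f i).eval x) < V.valuation (y i - b))
    {a₀ : Ω} (ha₀K : a₀ ∈ K)
    (hlin : ∀ i ∈ s, ∀ c ∈ K, V.valuation (x - c) ≤ V.valuation (x - a₀) →
      V.valuation ((f i).eval x - (f i).eval c) = β i * V.valuation (x - c))
    (hdom : ∀ i ∈ s, ∀ c ∈ K, V.valuation (x - c) ≤ V.valuation (x - a₀) →
      V.valuation ((hasseDeriv 1 (f i)).eval c - d i) < β i ∧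
      ∀ j, 2 ≤ j → V.valuation ((hasseDeriv j (f i)).eval c * (x - c) ^ j) <
        β i * V.valuation (x - c))
    (hmax : ∀ i ∈ s, V.valuation (kk i * d i) ≤ V.valuation (∑ i ∈ s, kk i * d i))
    (hne : ∑ i ∈ s, kk i * d i ≠ 0) :
    (∀ k, (∑ i ∈ s, C (kk i) * f i).coeff k ∈ K) ∧
    (∀ b ∈ K, V.valuation ((∑ i ∈ s, kk i * y i) - (∑ i ∈ s, C (kk i) * f i).eval x) <
      V.valuation ((∑ i ∈ s, kk i * y i) - b)) ∧
    ∀ c ∈ K, V.valuation (x - c) ≤ V.valuation (x - a₀) →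
      V.valuation ((∑ i ∈ s, C (kk i) * f i).eval x - (∑ i ∈ s, C (kk i) * f i).eval c) =
        V.valuation (∑ i ∈ s, kk i * d i) * V.valuation (x - c) ^ 1 := by
  classical
  have hxK : x ∉ K := not_mem_of_forall_eval_eq_zero K htrans
  set g : Polynomial Ω := ∑ i ∈ s, C (kk i) * f i with hg
  set Y : Ω := ∑ i ∈ s, kk i * y i with hY
  set D : Ω := ∑ i ∈ s, kk i * d i with hD
  have hvD0 : V.valuation D ≠ 0 := (_root_.map_ne_zero _).mpr hne
  have hxc0 : ∀ c ∈ K, V.valuation (x - c) ≠ 0 := fun c hc =>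
    (_root_.map_ne_zero _).mpr fun h0 => hxK (by rw [sub_eq_zero.mp h0]; exact hc)
  -- coefficients of `g`
  have hgK : ∀ k, g.coeff k ∈ K := by
    intro k
    rw [hg, finsetSum_coeff]
    refine Subfield.sum_mem _ fun i hi => ?_
    rw [coeff_C_mul]
    exact mul_mem (hkk i hi) (hf i hi k)
  -- Lemma 12.3
  have h123 := approximationDegree_one_sum V K s hxK f β d kk hd hdom hmax hne
  have hlinD : ∀ c ∈ K, V.valuation (x - c) ≤ V.valuation (x - a₀) →
      V.valuation (g.eval x - g.eval c) = V.valuation D * V.valuation (x - c) :=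
    fun c hc hle => (h123 c hc hle).2.2
  refine ⟨hgK, fun b hbK => ?_, fun c hc hle => by rw [pow_one]; exact hlinD c hc hle⟩
  -- `g` is non-constant
  have hdeg : 0 < g.natDegree := by
    by_contra h0
    obtain ⟨c₀, hc₀⟩ := natDegree_eq_zero.mp (Nat.eq_zero_of_not_pos h0)
    have h1 := hlinD a₀ ha₀K le_rfl
    rw [← hc₀, eval_C, eval_C, sub_self, map_zero] at h1
    exact mul_ne_zero hvD0 (hxc0 a₀ ha₀K) h1.symm
  -- a point `c` close to `x` with `|g x - g c| < |g x - b|`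
  obtain ⟨c, hcK, hcle, hclt⟩ := exists_valuation_eval_sub_eval_lt V K htrans hval hres h3 hgK hdeg hbK ha₀K
  -- `|Y - g x| < |g x - g c|`
  have hYg : Y - g.eval x = ∑ i ∈ s, kk i * (y i - (f i).eval x) := by
    rw [hY, hg, eval_finsetSum, ← Finset.sum_sub_distrib]
    refine Finset.sum_congr rfl fun i _ => ?_
    rw [eval_mul, eval_C]; ring
  have hγ0 : V.valuation (g.eval x - g.eval c) ≠ 0 := by
    rw [hlinD c hcK hcle]; exact mul_ne_zero hvD0 (hxc0 c hcK)
  have hlt1 : V.valuation (Y - g.eval x) < V.valuation (g.eval x - g.eval c) := by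
    rw [hYg]
    refine Valuation.map_sum_lt _ hγ0 fun i hi => ?_
    by_cases hki : kk i = 0
    · rw [hki, zero_mul, map_zero]; exact zero_lt_iff.mpr hγ0
    have hvki : 0 < V.valuation (kk i) := (Valuation.pos_iff _).mpr hki
    -- `|y i - f i x| < |f i x - f i c| = β i |x - c|`
    have hficK : (f i).eval c ∈ K := eval_mem_subfield_of_coeff_mem (hf i hi) hcK
    have h1 := hgood i hi _ hficK
    have h2 : V.valuation ((f i).eval x - (f i).eval c) = V.valuation (y i - (f i).eval c) := by
      have hid : (f i).eval x - (f i).eval c = (y i - (f i).eval c) - (y i - (f i).eval x) := by ring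
      rw [hid, Valuation.map_sub_eq_of_lt_left _ h1]
    rw [map_mul]
    calc V.valuation (kk i) * V.valuation (y i - (f i).eval x)
        < V.valuation (kk i) * V.valuation ((f i).eval x - (f i).eval c) := by
          rw [h2]; exact mul_lt_mul_of_pos_left h1 hvki
      _ = V.valuation (kk i * d i) * V.valuation (x - c) := by
          rw [hlin i hi c hcK hcle, map_mul, (hd i hi).2, mul_assoc]
      _ ≤ V.valuation D * V.valuation (x - c) := mul_le_mul' (hmax i hi) le_rfl
      _ = V.valuation (g.eval x - g.eval c) := (hlinD c hcK hcle).symm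
  have hlt2 : V.valuation (Y - g.eval x) < V.valuation (g.eval x - b) := lt_trans hlt1 hclt
  have hid : Y - b = (Y - g.eval x) + (g.eval x - b) := by ring
  rw [hid, Valuation.map_add_eq_of_lt_right _ hlt2]
  exact hlt2

end Sum

end Literature.AlgebraicGeometry.Resolution

end
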